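import Mathlib.NumberTheory.NumberField.CMField

/-!
# Tier-5 support (seat p3, cell pub-hodge-repro2) — `F = F⁺(√θ)`: `θ` is negative at every
real place of `F⁺` because `F` is totally imaginary

Behind route/T4-B1-p3.md v7 (sub-claim B1, FINAL) l. 22: «Throughout, F = F⁺(√θ) with θ ∈ F⁺ a
non-square (O'Meara §65A); θ is negative at every real place of F⁺ because F is totally imaginary
(if τ(θ) > 0 for some real τ, τ would extend to a real embedding of F⁺(√θ))», stated for
Mathlib's `NumberField.IsCMField K` with `K⁺ = NumberField.maximalRealSubfield K`.

The datum is an element `y ∈ K` with `y ∉ K⁺` (`complexConj K y ≠ y`) whose square lies in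
`K⁺` (`θ = y²`). Then the complex conjugation negates `y` (`complexConj_eq_neg`: from
`(c y + y)(c y − y) = c(y²) − y² = 0`), so every complex embedding `φ` of `K` sends `y` to a
purely imaginary non-zero number (`re_eq_zero`, `im_ne_zero`, via Mathlib's
`complexEmbedding_complexConj`) and `φ(y²) = −(im φ y)² < 0` (`embedding_sq`,
`embedding_sq_neg`). Restricting to `K⁺`: every embedding of `K⁺` — every real place — sends `θ`
to a negative real (`embedding_theta_neg`, `realEmbedding_neg`; the lift of the embedding to
`K` is Mathlib's `ComplexEmbedding.lift`). Finally `θ` is not a square in `K⁺`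
(`sq_ne_of_complexConj_ne`: a square root in `K⁺` would be `±y`, both fixed by the
conjugation) — O'Meara's «non-square», automatic from `y ∉ K⁺`.

Nothing here is a display; Mathlib only, no cell import. Header declaration (README §8(d)): uses
an L-value-free non-vanishing device: NO.
-/

open scoped ComplexConjugate
open NumberField NumberField.IsCMField

namespace Summit.Ventures.HodgeRepro2.T5CMTotallyNegative

variable (K : Type*) [Field K] [NumberField K] [IsCMField K]

/-! ## 1. The conjugation negates a square root of an element of `K⁺` lying outside `K⁺` -/

/-- If `y ∉ K⁺` but `y² ∈ K⁺`, the complex conjugation negates `y`: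
`(c y + y)(c y − y) = c(y²) − y² = 0` and `c y ≠ y`. -/
theorem complexConj_eq_neg {y : K} (hy : complexConj K y ≠ y)
    (hsq : complexConj K (y ^ 2) = y ^ 2) : complexConj K y = -y := by
  have h : (complexConj K y + y) * (complexConj K y - y) = 0 := by
    rw [← sq_sub_sq, ← map_pow, hsq, sub_self]
  rcases mul_eq_zero.mp h with h1 | h1
  · exact eq_neg_of_add_eq_zero_left h1
  · exact absurd (sub_eq_zero.mp h1) hy

/-- `θ = y²` is not a square in `K⁺` when `y ∉ K⁺`: a square root `s ∈ K⁺` would give `y = ±s`,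
both fixed by the conjugation (O'Meara's «θ ∈ F a non-square», automatic). -/
theorem sq_ne_of_complexConj_ne {θ : maximalRealSubfield K} {y : K}
    (hθ : algebraMap (maximalRealSubfield K) K θ = y ^ 2) (hy : complexConj K y ≠ y)
    (s : maximalRealSubfield K) : s ^ 2 ≠ θ := by
  intro hs
  have h : (algebraMap (maximalRealSubfield K) K s) ^ 2 = y ^ 2 := by rw [← map_pow, hs, hθ]
  rcases sq_eq_sq_iff_eq_or_eq_neg.mp h with h1 | h1
  · exact hy (by rw [← h1, AlgEquiv.commutes])
  · have hy' : y = -(algebraMap (maximalRealSubfield K) K s) := by rw [h1, neg_neg]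
    exact hy (by rw [hy', map_neg, AlgEquiv.commutes])

/-! ## 2. Under every complex embedding, `y` is purely imaginary and non-zero, so
`φ(y²) = −(im φ y)² < 0` -/

/-- A conjugation-negated element has purely imaginary values: `re (φ y) = 0`. -/
theorem re_eq_zero (φ : K →+* ℂ) {y : K} (hy : complexConj K y = -y) : (φ y).re = 0 := by
  have h := complexEmbedding_complexConj K φ y
  rw [hy, map_neg] at h
  have h2 := congrArg Complex.re h
  rw [Complex.neg_re, Complex.conj_re] at h2
  linarith

/-- … and non-zero ones: `im (φ y) ≠ 0` for `y ≠ 0`. -/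
theorem im_ne_zero (φ : K →+* ℂ) {y : K} (hy0 : y ≠ 0) (hy : complexConj K y = -y) :
    (φ y).im ≠ 0 := by
  intro him
  have hre := re_eq_zero K φ hy
  have h0 : φ y = 0 := Complex.ext (by simpa using hre) (by simpa using him)
  exact hy0 ((map_eq_zero φ).mp h0)

/-- `φ(y²) = −(im φ y)²` for a conjugation-negated `y`. -/
theorem embedding_sq (φ : K →+* ℂ) {y : K} (hy : complexConj K y = -y) :
    φ (y ^ 2) = -(((φ y).im ^ 2 : ℝ) : ℂ) := by
  have hre := re_eq_zero K φ hy
  rw [map_pow]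
  apply Complex.ext
  · simp [sq, Complex.mul_re, hre]
  · simp [sq, Complex.mul_im, hre]

/-- B1 l. 22, embedding form: for `y ∉ K⁺` with `y² ∈ K⁺`, every complex embedding of `K` sends
`y²` to a negative real number. -/
theorem embedding_sq_neg (φ : K →+* ℂ) {y : K} (hy : complexConj K y ≠ y)
    (hsq : complexConj K (y ^ 2) = y ^ 2) : (φ (y ^ 2)).re < 0 ∧ (φ (y ^ 2)).im = 0 := by
  have hneg := complexConj_eq_neg K hy hsq
  have hy0 : y ≠ 0 := fun h => hy (by rw [h, map_zero])
  have him := im_ne_zero K φ hy0 hneg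
  rw [embedding_sq K φ hneg]
  refine ⟨?_, by rw [Complex.neg_im, Complex.ofReal_im, neg_zero]⟩
  rw [Complex.neg_re, Complex.ofReal_re]
  exact neg_lt_zero.mpr (sq_pos_iff.mpr him)

/-! ## 3. Restricted to `K⁺`: `θ` is negative at every real place of `K⁺` -/

/-- B1 l. 22 for every embedding `φ₀ : K⁺ →+* ℂ` (every infinite place of the totally real
`K⁺`): `θ = y²` with `y ∉ K⁺` has `φ₀ θ` a negative real number. The embedding is lifted to `K`
by Mathlib's `ComplexEmbedding.lift` — the «τ would extend to an embedding of F⁺(√θ)» of B1. -/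
theorem embedding_theta_neg (φ₀ : maximalRealSubfield K →+* ℂ) {θ : maximalRealSubfield K}
    {y : K} (hθ : algebraMap (maximalRealSubfield K) K θ = y ^ 2) (hy : complexConj K y ≠ y) :
    (φ₀ θ).re < 0 ∧ (φ₀ θ).im = 0 := by
  have hsq : complexConj K (y ^ 2) = y ^ 2 := by rw [← hθ, AlgEquiv.commutes]
  have h := embedding_sq_neg K (ComplexEmbedding.lift K φ₀) hy hsq
  rwa [← hθ, ComplexEmbedding.lift_algebraMap_apply] at h

/-- B1 l. 22, real-place form: `θ = y²` with `y ∉ K⁺` is negative at every real place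
`ψ : K⁺ →+* ℝ` of `K⁺`. -/
theorem realEmbedding_neg (ψ : maximalRealSubfield K →+* ℝ) {θ : maximalRealSubfield K} {y : K}
    (hθ : algebraMap (maximalRealSubfield K) K θ = y ^ 2) (hy : complexConj K y ≠ y) :
    ψ θ < 0 := by
  have h := (embedding_theta_neg K (Complex.ofRealHom.comp ψ) hθ hy).1
  simpa using h

end Summit.Ventures.HodgeRepro2.T5CMTotallyNegative
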